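import Mathlib
import Literature.Computability.Complexity.RangeAvoidance
import Literature.Computability.Complexity.SignDegreeXor
import Summits.PneNP.PneNP.Theorems.PstarTyped

/-!
# Parity decision trees for the falsified-output search problem of a local-map fibre (ROUND-24 pre-seed, item T24.0)

FRONTIER range-avoidance ladder, rung F-N3 (cell `pnp-ideate`, ROUND-24 PRE-SEED §1–§2; restricted-model proof complexity —
nothing here bears on `P` vs `NP`).

Rungs R21–R23 showed that Sherali–Adams of level `n^{1−o(1)}` cannot certify `y ∉ Range(I)` for boundary-expanding pure
`P⋆` / `IP₃` instances, before and after the `𝔽₂`-linear quotient.  Sherali–Adams cannot quotient the `𝔽₂`-linear layer at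
all (the Grigoriev caveat: `Linearisable` instances are FP-easy and SA-blind at once), so the next restricted model on the
ladder must contain Gaussian elimination natively.  The combinatorial core of tree-like resolution over parities
(`Res(⊕)`, Itsykson–Sokolov 2014) is the PARITY DECISION TREE for the search problem

  `Search(I, y)`: given `z : Fin n → Bool`, name an output `j` with `I(z)_j ≠ y_j`

(total exactly when `y ∉ Range(I)`).  This file fixes the model:
* `PDT n m` — binary trees whose internal nodes query the parity `⊕_{v ∈ S} z_v` of a set `S` of input positions and whose
  leaves name an output; `run`, `depth`, `size` (number of leaves);
* `Solves T I y` — every input reaches a leaf naming an output it violates; `not_mem_range_of_solves` (a solved target is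
  outside the range) and `exists_solves_of_not_mem_range` (conversely the full tree querying every variable singly solves
  it, depth `n`) — so the quantity "least depth of a PDT solving `Search(I,y)`" lives in `[0, n]` for every non-image `y`;
* `size_le_two_pow_depth`.
The ROUND-24 research statements (depth `≥ n/c`, size `≥ 2^{n/c}` for every non-image target of some pure-`P⋆` family at every
linear stretch — the tree-like `Res(⊕)` statements via the Prover–Delayer characterisation of Itsykson–Sokolov /
Gryaznov–Ovcharov–Riazanov) are deliberately NOT declared here: their quantifier over targets (`∀ y ∉ Range` versus "most `y`")
is under the memo's kill test K1 first.  A depth-`d` PDT partitions `𝔽₂ⁿ` into `≤ 2^d` affine pieces each violating one output,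
so `𝔽₂`-Nullstellensatz degree is at most `d + 2`: PDT depth sits strictly below the open `PC_𝔽₂` question T21.2, and it is not
subject to the Grigoriev caveat (on `Linearisable` instances binary search along the linearised dependency has depth `O(log m)`).
For the boundary-expanding TYPED families of `PstarSAHeadline` / `SASubThreshold` the trivial upper bound is `|A| + O(log m)`
(query the AND layer, then binary search along a violated cycle of the XOR graph) — item T24.2.
-/

set_option linter.dupNamespace false

open Finset Literature.Computability.Complexity
open Summit.PneNP.PneNP.Theorems.PstarTyped (Typed)

namespace Summit.PneNP.PneNP.Theorems.PstarPDT

variable {k n m : ℕ}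

/-! ## Parity decision trees -/

/-- A parity decision tree over `n` Boolean inputs with leaves naming one of `m` outputs: a leaf, or a query node
`⊕_{v ∈ S} z_v` with the subtree for answer `false` and the subtree for answer `true`. -/
inductive PDT (n m : ℕ) : Type
  | leaf : Fin m → PDT n m
  | node : Finset (Fin n) → PDT n m → PDT n m → PDT n m

/-- The parity `⊕_{v ∈ S} z_v` of the input `z` on the query set `S`. -/
def parity (S : Finset (Fin n)) (z : Fin n → Bool) : Bool :=
  decide (Odd (S.filter fun v => z v = true).card)

namespace PDT

/-- The leaf reached by input `z`. -/
def run : PDT n m → (Fin n → Bool) → Fin m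
  | leaf j, _ => j
  | node S t₀ t₁, z => if parity S z then t₁.run z else t₀.run z

/-- Depth (longest root–leaf path, counted in queries). -/
def depth : PDT n m → ℕ
  | leaf _ => 0
  | node _ t₀ t₁ => max t₀.depth t₁.depth + 1

/-- Size = number of leaves. -/
def size : PDT n m → ℕ
  | leaf _ => 1
  | node _ t₀ t₁ => t₀.size + t₁.size

/-- `T` SOLVES the falsified-output search problem `Search(I, y)`: every input reaches a leaf naming an output whose value
under `I` differs from the target bit. -/
def Solves (T : PDT n m) (I : LocalMap k n m) (y : Fin m → Bool) : Prop :=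
  ∀ z : Fin n → Bool, I.eval z (T.run z) ≠ y (T.run z)

/-- One leaf per unit of size: `size T ≥ 1`. -/
theorem one_le_size (T : PDT n m) : 1 ≤ T.size := by
  induction T with
  | leaf _ => simp [size]
  | node _ t₀ t₁ h₀ _ => simp only [size]; omega

/-- A tree of depth `d` has at most `2^d` leaves. -/
theorem size_le_two_pow_depth (T : PDT n m) : T.size ≤ 2 ^ T.depth := by
  induction T with
  | leaf _ => simp [size, depth]
  | node _ t₀ t₁ h₀ h₁ =>
    simp only [size, depth, pow_succ]
    have e₀ : 2 ^ t₀.depth ≤ 2 ^ max t₀.depth t₁.depth := Nat.pow_le_pow_right (by norm_num) (le_max_left _ _)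
    have e₁ : 2 ^ t₁.depth ≤ 2 ^ max t₀.depth t₁.depth := Nat.pow_le_pow_right (by norm_num) (le_max_right _ _)
    omega

end PDT

/-! ## Solvability is exactly non-membership in the range -/

/-- A solved target is outside the range: on an input `x` with `I(x) = y` no leaf can name a violated output. -/
theorem not_mem_range_of_solves {T : PDT n m} {I : LocalMap k n m} {y : Fin m → Bool} (h : T.Solves I y) :
    y ∉ I.range := by
  rintro ⟨x, hx⟩
  exact h x (by rw [hx])

/-- The parity of a singleton query is the queried bit. -/
theorem parity_singleton (v : Fin n) (z : Fin n → Bool) : parity {v} z = z v := by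
  unfold parity
  by_cases hz : z v = true
  · simp [Finset.filter_singleton, hz]
  · simp only [Bool.not_eq_true] at hz
    simp [Finset.filter_singleton, hz]

section FullTree

variable (I : LocalMap k n m) (y : Fin m → Bool) (j₀ : Fin m)

/-- Leaf label of the full tree: a violated output of the (by then completely known) input, if any; else `j₀`. -/
noncomputable def pick (ρ : Fin n → Bool) : Fin m :=
  if h : ∃ j, I.eval ρ j ≠ y j then h.choose else j₀

/-- The full tree: query the variables `i, i+1, …, n−1` singly, recording the answers in `ρ`. -/
noncomputable def full : ℕ → (Fin n → Bool) → PDT n m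
  | i, ρ =>
    if h : i < n then
      PDT.node {⟨i, h⟩} (full (i + 1) (Function.update ρ ⟨i, h⟩ false)) (full (i + 1) (Function.update ρ ⟨i, h⟩ true))
    else PDT.leaf (pick I y j₀ ρ)
  termination_by i => n - i

/-- The full tree from position `i` has depth `n − i`. -/
theorem depth_full : ∀ (i : ℕ) (ρ : Fin n → Bool), (full I y j₀ i ρ).depth = n - i := by
  intro i
  induction' hd : n - i with d ih generalizing i
  · intro ρ
    rw [full]
    have : ¬ i < n := by omega
    simp [this, PDT.depth]
  · intro ρ
    rw [full]
    have hi : i < n := by omega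
    simp only [hi, dite_true, PDT.depth]
    rw [ih (i + 1) (by omega), ih (i + 1) (by omega)]
    simp

/-- Running the full tree from position `i` on `z`, with `ρ` agreeing with `z` below `i`, ends at `pick` of `z` itself. -/
theorem run_full (z : Fin n → Bool) : ∀ (i : ℕ) (ρ : Fin n → Bool), (∀ v : Fin n, v.val < i → ρ v = z v) →
    (full I y j₀ i ρ).run z = pick I y j₀ (fun v => if v.val < i then ρ v else z v) := by
  intro i
  induction' hd : n - i with d ih generalizing i
  · intro ρ hlt
    rw [full]
    have hi : ¬ i < n := by omega
    simp only [hi, dite_false, PDT.run]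
    congr 1
    funext v
    have : v.val < i := by omega
    simp [this, hlt v this]
  · intro ρ hlt
    rw [full]
    have hi : i < n := by omega
    simp only [hi, dite_true, PDT.run, parity_singleton]
    have key : ∀ b : Bool, z ⟨i, hi⟩ = b →
        (full I y j₀ (i + 1) (Function.update ρ ⟨i, hi⟩ b)).run z =
          pick I y j₀ (fun v => if v.val < i then ρ v else z v) := by
      intro b hb
      rw [ih (i + 1) (by omega) (Function.update ρ ⟨i, hi⟩ b) ?_]
      · congr 1
        funext v
        by_cases h1 : v.val < i
        · have h2 : v.val < i + 1 := by omega
          have h3 : v ≠ ⟨i, hi⟩ := by intro e; subst e; simp at h1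
          simp [h1, h2, Function.update_of_ne h3]
        · by_cases h2 : v.val < i + 1
          · have h3 : v = ⟨i, hi⟩ := by ext; simp; omega
            subst h3
            simp [h2, hb]
          · simp [h1, h2]
      · intro v hv
        by_cases h3 : v = ⟨i, hi⟩
        · subst h3; simp [hb]
        · rw [Function.update_of_ne h3]
          exact hlt v (by have : v.val ≠ i := fun e => h3 (by ext; exact e); omega)
    by_cases hz : z ⟨i, hi⟩ = true
    · simp only [hz, if_true]; exact key true hz
    · simp only [Bool.not_eq_true] at hz
      simp only [hz, Bool.false_eq_true, if_false]; exact key false hz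

/-- Conversely, every non-image target is solved by the full tree, of depth `n` (so the least solving depth lies in `[0, n]`). -/
theorem exists_solves_of_not_mem_range (hy : y ∉ I.range) : ∃ T : PDT n m, T.Solves I y ∧ T.depth ≤ n := by
  have hm : 0 < m := by
    rcases Nat.eq_zero_or_pos m with h0 | hpos
    · subst h0
      exact absurd ⟨fun _ => false, funext fun j => j.elim0⟩ hy
    · exact hpos
  refine ⟨full I y ⟨0, hm⟩ 0 (fun _ => false), ?_, by rw [depth_full]; simp⟩
  intro z
  rw [run_full I y ⟨0, hm⟩ z 0 (fun _ => false) (fun v hv => absurd hv (Nat.not_lt_zero _))]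
  have hz : (fun v : Fin n => if v.val < 0 then false else z v) = z := by funext v; simp
  rw [hz]
  have hex : ∃ j, I.eval z j ≠ y j := by
    by_contra hne
    push Not at hne
    exact hy ⟨z, funext hne⟩
  unfold pick
  rw [dif_pos hex]
  exact hex.choose_spec

end FullTree

end Summit.PneNP.PneNP.Theorems.PstarPDT
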